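import Mathlib
import Summits.Ventures.HodgeRepro2.T5AmiceDirac
import Summits.Ventures.HodgeRepro2.T5LambdaUnion
import Summits.Ventures.HodgeRepro2.T5PropGBranchMeasure

/-!
# T5AmiceToy — toy instances of the μ / λ / zero-set theorems: `δ_a` and `δ_1 − δ_0`

Cell pub-hodge-repro2, Tier 5 support (seat p7; route/T5-CHECK-G-p7.md §3 S5). Non-vacuity witnesses in
the spirit of README §10.5(ii)(c)/(d) for the measure-model theorems of T5MuInvariantAmice,
T5LambdaInvariant, T5AmiceConvolution and T5LambdaUnion, on `R = ℤ_p`: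

* the Dirac measure `δ_a` (T5AmiceDirac): bounded by `1`, non-zero, `μ(δ_a) = 0`, `λ(δ_a) = 0`
  (`f_{δ_a}` has constant term `1`), hence — by `map_ne_zero_of_lambda_eq_zero` — NO continuous character
  is killed: `Z(δ_a) = ∅` (`zeroSet_dirac`; directly: `κ a` is a unit);
* the measure `m := δ_1 − δ_0` with `f_m = (1 + T) − 1 = T`: `μ(m) = 0`, `λ(m) = 1`, and exactly ONE
  continuous character is killed — the trivial one (`zeroSet_sub01`, `ncard_zeroSet_sub01`): the bound
  `#Z ≤ λ` of T5LambdaInvariant is ATTAINED here;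
* `m * m` (T5AmiceConvolution): `μ = 0`, `λ = 2` by the additivity of T5LambdaUnion;
* the skeleton's hypotheses (T5PropGSkeleton `FinitelyManyZeros`, `InterpolationTransfer`) instantiate
  JOINTLY on the branch data of `m = δ_1 − δ_0` with `L ≡ 1` (`skeleton_witness`) — the §10.5(ii)(d)
  «joint-consistency sanity» for the measure-side hypotheses of Proposition G (i).

Mathlib + own files only.
-/

namespace Summit.Ventures.HodgeRepro2.T5AmiceToy

open PadicInt Filter Topology
open Summit.Ventures.HodgeRepro2
open Summit.Ventures.HodgeRepro2.T5AmiceTransform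
open Summit.Ventures.HodgeRepro2.T5AmiceDirac
open Summit.Ventures.HodgeRepro2.T5MuInvariantPadic
open Summit.Ventures.HodgeRepro2.T5MuInvariantAmice
open Summit.Ventures.HodgeRepro2.T5LambdaInvariant
open Summit.Ventures.HodgeRepro2.T5FiniteZerosUnion
open Summit.Ventures.HodgeRepro2.T5AmiceConvolution
open Summit.Ventures.HodgeRepro2.T5LambdaUnion

variable {p : ℕ} [hp : Fact p.Prime]

/-! ### The Dirac measure `δ_a` -/

/-- `δ_a` is bounded by `1`. -/
theorem dirac_bound (a : ℤ_[p]) (φ : C(ℤ_[p], ℤ_[p])) : ‖dirac (R := ℤ_[p]) a φ‖ ≤ 1 * ‖φ‖ :=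
  norm_dirac_le a φ

/-- `δ_a ≠ 0` (it sends the constant `1` to `1`). -/
theorem dirac_ne_zero (a : ℤ_[p]) : dirac (R := ℤ_[p]) a ≠ 0 := by
  intro h
  have := congrArg (fun m : C(ℤ_[p], ℤ_[p]) →ₗ[ℤ_[p]] ℤ_[p] => m 1) h
  simp at this

/-- The constant term of `f_{δ_a}` is `1`. -/
theorem coeff_zero_amice_dirac (a : ℤ_[p]) :
    PowerSeries.coeff 0 (amice (dirac (R := ℤ_[p]) a)) = 1 := by
  rw [coeff_amice, dirac_apply, mahlerTerm_apply, mahler_apply, Ring.choose_zero_right, one_smul]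

/-- `μ(δ_a) = 0`. -/
theorem mu_dirac (a : ℤ_[p]) : mu p (dirac (R := ℤ_[p]) a) = 0 := by
  rw [mu_eq_zero_iff_exists_isUnit_coeff _ zero_le_one (dirac_bound a)]
  exact ⟨0, by rw [coeff_zero_amice_dirac]; exact isUnit_one⟩

/-- `λ(δ_a) = 0`: the constant term already has the minimal valuation. -/
theorem lambda_dirac (a : ℤ_[p]) : lambda (dirac (R := ℤ_[p]) a) = 0 := by
  rw [lambda_eq_zero_iff _ zero_le_one (dirac_bound a) (dirac_ne_zero a), coeff_zero_amice_dirac,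
    mu_dirac]
  simp [vp_of_ne_zero]

/-- No continuous character is killed by `δ_a` — via `λ(δ_a) = 0`. -/
theorem dirac_char_ne_zero (a : ℤ_[p]) (κ : AddChar ℤ_[p] ℤ_[p]) (hκ : Continuous κ) :
    dirac (R := ℤ_[p]) a ⟨κ, hκ⟩ ≠ 0 :=
  map_ne_zero_of_lambda_eq_zero _ zero_le_one (dirac_bound a) (dirac_ne_zero a) (lambda_dirac a) κ hκ

/-- The same directly: `κ a` is a unit of `ℤ_p`, in particular `≠ 0`. -/
theorem dirac_char_ne_zero' (a : ℤ_[p]) (κ : AddChar ℤ_[p] ℤ_[p]) (hκ : Continuous κ) :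
    dirac (R := ℤ_[p]) a ⟨κ, hκ⟩ ≠ 0 := by
  rw [dirac_apply]
  exact (AddChar.val_isUnit κ a).ne_zero

/-- `Z(δ_a) = ∅`. -/
theorem zeroSet_dirac (a : ℤ_[p]) : zeroSet (dirac (R := ℤ_[p]) a) = ∅ := by
  ext κ
  simp only [mem_zeroSet, Set.mem_empty_iff_false, iff_false]
  exact dirac_char_ne_zero a κ.1 κ.2

/-! ### The measure `m = δ_1 − δ_0`, `f_m = T` -/

/-- `m := δ_1 − δ_0`. -/
noncomputable def sub01 : C(ℤ_[p], ℤ_[p]) →ₗ[ℤ_[p]] ℤ_[p] :=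
  dirac (R := ℤ_[p]) 1 - dirac (R := ℤ_[p]) 0

/-- `m φ = φ 1 − φ 0`. -/
@[simp] theorem sub01_apply (φ : C(ℤ_[p], ℤ_[p])) : sub01 φ = φ 1 - φ 0 := rfl

/-- `m` is bounded by `1` (ultrametric: `‖φ 1 − φ 0‖ ≤ max ‖φ 1‖ ‖φ 0‖ ≤ ‖φ‖`). -/
theorem sub01_bound (φ : C(ℤ_[p], ℤ_[p])) : ‖sub01 φ‖ ≤ 1 * ‖φ‖ := by
  rw [sub01_apply, one_mul, sub_eq_add_neg]
  refine (IsUltrametricDist.norm_add_le_max _ _).trans (max_le (φ.norm_coe_le_norm 1) ?_)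
  rw [norm_neg]
  exact φ.norm_coe_le_norm 0

/-- `f_m = T`. -/
theorem amice_sub01 : amice (sub01 (p := p)) = PowerSeries.X := by
  rw [sub01, amice_sub, amice_dirac_one, amice_dirac_zero, add_sub_cancel_left]

/-- `m ≠ 0`. -/
theorem sub01_ne_zero : sub01 (p := p) ≠ 0 := by
  intro h
  have := congrArg amice h
  rw [amice_sub01] at this
  have h0 := congrArg (PowerSeries.coeff 1) this
  simp at h0

/-- `μ(m) = 0` (the coefficient of `T` is the unit `1`). -/
theorem mu_sub01 : mu p (sub01 (p := p)) = 0 := by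
  rw [mu_eq_zero_iff_exists_isUnit_coeff _ zero_le_one sub01_bound]
  exact ⟨1, by rw [amice_sub01, PowerSeries.coeff_one_X]; exact isUnit_one⟩

/-- `λ(m) = 1`: the constant term is `0`, the coefficient of `T` is a unit. -/
theorem lambda_sub01 : lambda (sub01 (p := p)) = 1 := by
  apply le_antisymm
  · apply lambda_le
    rw [amice_sub01, PowerSeries.coeff_one_X, mu_sub01, vp_of_ne_zero p one_ne_zero]
    simp
  · rw [Nat.one_le_iff_ne_zero, Ne, lambda_eq_zero_iff _ zero_le_one sub01_bound sub01_ne_zero,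
      amice_sub01, PowerSeries.coeff_zero_X, vp_zero, mu_sub01]
    exact ENat.top_ne_zero

/-- `m` kills a continuous character `κ` iff `κ 1 = 1` iff `κ` is the trivial character. -/
theorem sub01_char_eq_zero_iff (κ : AddChar ℤ_[p] ℤ_[p]) (hκ : Continuous κ) :
    sub01 ⟨κ, hκ⟩ = 0 ↔ κ = 1 := by
  rw [sub01_apply]
  change κ 1 - κ 0 = 0 ↔ κ = 1
  rw [AddChar.map_zero_eq_one, sub_eq_zero]
  constructor
  · intro h
    exact T5PadicFiniteOrderCharacters.eq_of_eval_one_eq hκ continuous_const (by rw [h]; rfl)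
  · rintro rfl
    rfl

/-- `Z(m) = {1}`: exactly the trivial character is killed. -/
theorem zeroSet_sub01 :
    zeroSet (sub01 (p := p)) = {⟨1, continuous_const⟩} := by
  ext κ
  rw [mem_zeroSet, Set.mem_singleton_iff, sub01_char_eq_zero_iff κ.1 κ.2]
  exact ⟨fun h => Subtype.ext h, fun h => congrArg Subtype.val h⟩

/-- `#Z(m) = 1 = λ(m)`: the bound `#Z ≤ λ` of T5LambdaInvariant is attained. -/
theorem ncard_zeroSet_sub01 : (zeroSet (sub01 (p := p))).ncard = lambda (sub01 (p := p)) := by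
  rw [zeroSet_sub01, Set.ncard_singleton, lambda_sub01]

/-- Consistency check against the general bound. -/
theorem ncard_zeroSet_sub01_le : (zeroSet (sub01 (p := p))).ncard ≤ lambda (sub01 (p := p)) :=
  ncard_zeroSet_le_lambda _ zero_le_one sub01_bound sub01_ne_zero

/-! ### The convolution `m * m`, `f = T²` -/

/-- `μ(m * m) = 0`. -/
theorem mu_conv_sub01 :
    mu p (conv (sub01 (p := p)) sub01 (continuous_of_bound _ 1 sub01_bound)) = 0 := by
  rw [mu_conv _ _ zero_le_one zero_le_one sub01_bound sub01_bound sub01_ne_zero sub01_ne_zero,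
    mu_sub01, add_zero]

/-- `λ(m * m) = 2`. -/
theorem lambda_conv_sub01 :
    lambda (conv (sub01 (p := p)) sub01 (continuous_of_bound _ 1 sub01_bound)) = 2 := by
  rw [lambda_conv _ _ zero_le_one zero_le_one sub01_bound sub01_bound sub01_ne_zero sub01_ne_zero,
    lambda_sub01]

/-- `f_{m * m} = T²`. -/
theorem amice_conv_sub01 :
    amice (conv (sub01 (p := p)) sub01 (continuous_of_bound _ 1 sub01_bound)) = PowerSeries.X ^ 2 := by
  rw [amice_conv, amice_sub01, sq]

/-! ### The skeleton's hypotheses instantiate jointly -/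

open Summit.Ventures.HodgeRepro2.T5PropGSkeleton in
/-- Joint-consistency witness: on the branch data of `m = δ_1 − δ_0` with `L ≡ 1`, both hypotheses of
the skeleton of Proposition G (i) hold — `FinitelyManyZeros` (exactly one zero) and
`InterpolationTransfer` (`L` never vanishes). -/
theorem skeleton_witness :
    FinitelyManyZeros (T5PropGBranchMeasure.branchData (sub01 (p := p)) fun _ => (1 : ℂ)) ∧
      InterpolationTransfer (T5PropGBranchMeasure.branchData (sub01 (p := p)) fun _ => (1 : ℂ)) := by
  refine ⟨?_, fun _ _ => one_ne_zero⟩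
  exact T5PropGBranchMeasure.finitelyManyZeros_branchData sub01 (continuous_of_bound _ 1 sub01_bound)
    sub01_ne_zero _

end Summit.Ventures.HodgeRepro2.T5AmiceToy
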